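import Mathlib
import Summits.ValiantsHypothesis.ValiantsHypothesis.Theorems.BinomialElusiveBinomialCandidateAffinePeeling
import Summits.ValiantsHypothesis.ValiantsHypothesis.Theorems.BinomialElusiveBinomialCandidateMonomialSubstitution
import Literature.Combinatorics.SimpleGraph.ShortEvenClosedWalk

/-!
# Crux `BinomialElusive.BinomialCandidate` (stmt-ValiantsHypothesis-7392), line `registered` —
# helper for the stubs `stub_integralPeeling` / `stub_polarPeeling`: the VALUATIVE (honest) corner

The registered stubs ask, for a quadratic `Γ : ℂ^{m-1} → ℂ^m` and a formal Laurent solution `p`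
of `Γ(p) = (t^{N a_i} + t^{N b_i})_i`, for a nonzero integer relation among the `2m` exponents of
length `≤ ⌊log₂ m⌋²`.

This file proves it — for ARBITRARY `Γ` and ARBITRARY Laurent `p`, uniformly in `m ≥ 64` — under
the hypothesis that every one of the `2m` target exponents `N a_i`, `N b_i` is a sum of two
VALUATIONS `θ_x + θ_y`, where the vertices are `V = {0} ⊔ {1, …, m-1}` (`Option (Fin (m-1))`),
`θ_0 = 0` and `θ_j = ord p_j`: `integralPeeling_valuative`.  This is the "honest" case (no target
exponent is created by cancellation, Garg–Makam–Oliveira–Wigderson 2019, arXiv:1904.04299, §9)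
and it abstracts the monomial-substitution corner
(`BinomialElusiveBinomialCandidateMonomialSubstitution`): there the hypothesis is automatic.  It
records formally that a counterexample to the stubs must create a target exponent outside
`A + A`, `A = {0} ∪ {ord p_j}`.

Proof.  Purely combinatorial (`ValuativePeeling.shortRelation_of_edges`, any finite vertex set
`V` with `|V| ≤ m` and any potential `θ : V → ℤ`).  Degenerate data (the `2m` exponents not
pairwise distinct) are a relation of length `2` (`AffinePeeling.shortRelation_of_not_injective`).
Otherwise the `2m` targets are `2m` pairwise distinct edges `s(x, y)` (loops allowed) on `≤ m`
vertices; the girth lemma (`Literature.Combinatorics.SimpleGraph.exists_short_even_closed_walk`,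
`m ≥ 64`) gives a closed walk of even length `L ≤ ⌊log₂ m⌋²` along these edges using some edge
exactly once, and its alternating edge sum, read on the targets, is a nonzero `(u, v)` with
`Σ(|u_i| + |v_i|) ≤ L` and `N Σ(u_i a_i + v_i b_i) = Σ_s (-1)^s (θ(ω_s) + θ(ω_{s+1})) = 0`
(telescoping, `MonomialSubstitution.alternating_sum_telescope`).
-/

-- layout Summits/ValiantsHypothesis/ValiantsHypothesis forces the duplicated namespace component
set_option linter.dupNamespace false

namespace Summit.ValiantsHypothesis.ValiantsHypothesis.Theorems.BinomialCandidateStubs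

open scoped BigOperators
open Finset

namespace ValuativePeeling

/-- **The combinatorial core.**  If each of the `2m` numbers `N a_i`, `N b_i` (`N > 0`, `m ≥ 64`)
is `θ x + θ y` for two (possibly equal) vertices of a finite set `V` with `|V| ≤ m` and a potential
`θ : V → ℤ`, then the exponents `a, b` satisfy a nonzero integer relation of length `≤ ⌊log₂ m⌋²`.
(Distinct exponents are distinct edges of a multigraph with `2m ≥ 2|V|` edges; a short even closed
walk using some edge once has a nonzero, telescoping alternating edge sum.) -/
theorem shortRelation_of_edges {m : ℕ} (hm : 64 ≤ m) (a b : Fin m → ℕ) {N : ℕ} (hN : 0 < N)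
    {V : Type*} [Fintype V] [DecidableEq V] (hV : Fintype.card V ≤ m) (θ : V → ℤ)
    (hval : ∀ i, ∀ e ∈ ({a i, b i} : Finset ℕ), ∃ x y, ((N * e : ℕ) : ℤ) = θ x + θ y) :
    ∃ u v : Fin m → ℤ, (u, v) ≠ 0 ∧ ∑ i, (|u i| + |v i|) ≤ ((Nat.log 2 m ^ 2 : ℕ) : ℤ) ∧
      ∑ i, (u i * (a i : ℤ) + v i * (b i : ℤ)) = 0 := by
  classical
  by_cases hab : Function.Injective (Sum.elim a b)
  swap
  · exact AffinePeeling.shortRelation_of_not_injective (by omega) a b hab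
  obtain ⟨hinja, hinjb, hab'⟩ := Sum.elim_injective.mp hab
  -- edge values `Θ`, targets `X`
  set Θ : Sym2 V → ℤ := Sym2.lift ⟨fun x y => θ x + θ y, fun _ _ => add_comm _ _⟩ with hΘ
  set X : Fin m × Bool → ℤ := fun τ => ((N * (if τ.2 then b τ.1 else a τ.1) : ℕ) : ℤ) with hX
  -- every target exponent is an edge value
  have hedge : ∀ τ, ∃ ε, X τ = Θ ε := by
    rintro ⟨i, bb⟩
    cases bb
    · obtain ⟨x, y, h⟩ := hval i (a i) (by simp)
      exact ⟨s(x, y), by simpa [hX, hΘ] using h⟩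
    · obtain ⟨x, y, h⟩ := hval i (b i) (by simp)
      exact ⟨s(x, y), by simpa [hX, hΘ] using h⟩
  choose ε hε using hedge
  -- `X` (hence `ε`) is injective: the exponents are pairwise distinct
  have hXinj : Function.Injective X := by
    rintro ⟨i, bi⟩ ⟨j, bj⟩ h
    simp only [hX, Nat.cast_inj] at h
    have h' := Nat.eq_of_mul_eq_mul_left hN h
    cases bi <;> cases bj <;> simp only [Bool.false_eq_true, if_false, if_true] at h'
    · rw [hinja h']
    · exact absurd h' (hab' i j)
    · exact absurd h'.symm (hab' j i)
    · rw [hinjb h']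
  have hεinj : Function.Injective ε := fun τ τ' h => hXinj (by rw [hε τ, hε τ', h])
  -- the girth lemma on `E = image ε`
  have hm0 : 0 < m := by omega
  haveI : Nonempty V := by
    obtain ⟨x, -, -⟩ := hval ⟨0, hm0⟩ (a ⟨0, hm0⟩) (by simp)
    exact ⟨x⟩
  set E : Finset (Sym2 V) := univ.image ε with hE
  have hEcard : #E = 2 * m := by
    rw [hE, card_image_of_injective _ hεinj, card_univ, Fintype.card_prod, Fintype.card_fin,
      Fintype.card_bool, mul_comm]
  obtain ⟨L, ω, s₀, hL, hLeven, hs₀, hclosed, hωE, honce⟩ :=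
    Literature.Combinatorics.SimpleGraph.exists_short_even_closed_walk E hm hV
      (by rw [hEcard]; omega)
  -- the alternating edge sum, read on the targets
  set w : Fin m × Bool → ℤ := fun τ =>
    ∑ s ∈ range L, if s(ω s, ω (s + 1)) = ε τ then (-1 : ℤ) ^ s else 0 with hw
  -- each step's edge is `ε τ` for exactly one target `τ`
  have hfib : ∀ s < L, #(univ.filter fun τ => ε τ = s(ω s, ω (s + 1))) = 1 := by
    intro s hs
    obtain ⟨τ, -, hτ⟩ := mem_image.mp (hωE s hs)
    rw [card_eq_one]
    refine ⟨τ, eq_singleton_iff_unique_mem.mpr ⟨mem_filter.mpr ⟨mem_univ _, hτ⟩, fun τ' hτ' => ?_⟩⟩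
    exact hεinj ((mem_filter.mp hτ').2.trans hτ.symm)
  have hfib' : ∀ s < L, ∀ g : Fin m × Bool → ℤ, (∀ τ τ', ε τ = s(ω s, ω (s + 1)) →
      ε τ' = s(ω s, ω (s + 1)) → g τ = g τ') →
      ∑ τ, (if s(ω s, ω (s + 1)) = ε τ then g τ else 0) =
        ∑ τ ∈ univ.filter (fun τ => ε τ = s(ω s, ω (s + 1))), g τ := by
    intro s _ g _
    rw [sum_filter]
    exact sum_congr rfl fun τ _ => by simp only [eq_comm]
  refine ⟨fun i => w (i, false), fun i => w (i, true), ?_, ?_, ?_⟩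
  · -- nonzero: the target of the once-traversed edge has coefficient `± 1`
    obtain ⟨τ₀, -, hτ₀⟩ := mem_image.mp (hωE s₀ hs₀)
    have hw0 : w τ₀ = (-1) ^ s₀ := by
      simp only [hw]
      rw [sum_eq_single s₀]
      · rw [if_pos hτ₀.symm]
      · intro s hs hss
        rw [if_neg]
        intro h
        exact hss (honce s (mem_range.mp hs) (h.trans hτ₀))
      · intro h; exact absurd (mem_range.mpr hs₀) h
    have hne : w τ₀ ≠ 0 := by rw [hw0]; exact pow_ne_zero _ (by norm_num)
    intro h0
    obtain ⟨i, bb⟩ := τ₀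
    cases bb
    · exact hne (by simpa using congr_fun (congr_arg Prod.fst h0) i)
    · exact hne (by simpa using congr_fun (congr_arg Prod.snd h0) i)
  · -- length `≤ L ≤ ⌊log₂ m⌋²`
    have hlen : ∑ τ, |w τ| ≤ (L : ℤ) := by
      calc ∑ τ, |w τ| ≤ ∑ τ, ∑ s ∈ range L, (if s(ω s, ω (s + 1)) = ε τ then (1 : ℤ) else 0) := by
            refine sum_le_sum fun τ _ => (abs_sum_le_sum_abs _ _).trans (sum_le_sum fun s _ => ?_)
            split_ifs <;> simp
        _ = ∑ s ∈ range L, ∑ τ, (if s(ω s, ω (s + 1)) = ε τ then (1 : ℤ) else 0) := sum_comm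
        _ = ∑ s ∈ range L, (1 : ℤ) := by
            refine sum_congr rfl fun s hs => ?_
            rw [hfib' s (mem_range.mp hs) (fun _ => 1) (fun _ _ _ _ => rfl), sum_const,
              hfib s (mem_range.mp hs)]
            simp
        _ = L := by simp
    calc ∑ i, (|w (i, false)| + |w (i, true)|) = ∑ τ, |w τ| := by
          rw [Fintype.sum_prod_type]
          exact sum_congr rfl fun i _ => by simp [add_comm]
      _ ≤ L := hlen
      _ ≤ ((Nat.log 2 m ^ 2 : ℕ) : ℤ) := by exact_mod_cast hL
  · -- the relation: `N Σ (u a + v b) = Σ_τ w τ X τ = Σ_s (-1)^s Θ(edge s) = 0`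
    have hNX : ∀ i, (w (i, false) * (a i : ℤ) + w (i, true) * (b i : ℤ)) * N =
        w (i, false) * X (i, false) + w (i, true) * X (i, true) := fun i => by
      simp only [hX, Bool.false_eq_true, if_false, if_true, Nat.cast_mul]; ring
    have hsumX : ∑ τ, w τ * X τ = ∑ s ∈ range L, (-1 : ℤ) ^ s * Θ (s(ω s, ω (s + 1))) := by
      calc ∑ τ, w τ * X τ
          = ∑ τ, ∑ s ∈ range L, (if s(ω s, ω (s + 1)) = ε τ then (-1 : ℤ) ^ s * Θ (ε τ) else 0) := by
            refine sum_congr rfl fun τ _ => ?_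
            rw [hw, sum_mul]
            exact sum_congr rfl fun s _ => by rw [ite_mul, zero_mul, hε τ]
        _ = ∑ s ∈ range L, ∑ τ, (if s(ω s, ω (s + 1)) = ε τ then (-1 : ℤ) ^ s * Θ (ε τ) else 0) :=
            sum_comm
        _ = ∑ s ∈ range L, (-1 : ℤ) ^ s * Θ (s(ω s, ω (s + 1))) := by
            refine sum_congr rfl fun s hs => ?_
            rw [hfib' s (mem_range.mp hs) (fun τ => (-1 : ℤ) ^ s * Θ (ε τ))
              (fun τ τ' h h' => by rw [h, h'])]
            rw [sum_congr rfl fun τ hτ => by rw [(mem_filter.mp hτ).2], sum_const,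
              hfib s (mem_range.mp hs)]
            simp
    have htel : ∑ s ∈ range L, (-1 : ℤ) ^ s * Θ (s(ω s, ω (s + 1))) = 0 := by
      have : ∀ s, Θ (s(ω s, ω (s + 1))) = (fun s => θ (ω s)) s + (fun s => θ (ω s)) (s + 1) :=
        fun s => by simp [hΘ]
      simp only [this]
      rw [MonomialSubstitution.alternating_sum_telescope, hclosed, Even.neg_one_pow hLeven, one_mul,
        sub_self]
    have hN0 : (N : ℤ) ≠ 0 := by exact_mod_cast hN.ne'
    have key : (∑ i, (w (i, false) * (a i : ℤ) + w (i, true) * (b i : ℤ))) * N = 0 := by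
      rw [sum_mul, sum_congr rfl fun i _ => hNX i]
      have : ∑ i, (w (i, false) * X (i, false) + w (i, true) * X (i, true)) = ∑ τ, w τ * X τ := by
        rw [Fintype.sum_prod_type]
        exact sum_congr rfl fun i _ => by simp [add_comm]
      rw [this, hsumX, htel]
    exact (mul_eq_zero.mp key).resolve_right hN0

end ValuativePeeling

/-- **The valuative corner, vertex form.**  The registered stubs' conclusion for `m ≥ 64` from the
sole hypothesis that every target exponent `N a_i`, `N b_i` is `θ x + θ y` for two vertices
`x, y ∈ Option (Fin (m-1))` and some potential `θ` (in the application `θ none = 0`,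
`θ (some j) = ord p_j`). -/
theorem peeling_valuative {m : ℕ} (hm : 64 ≤ m) (a b : Fin m → ℕ) (N : ℕ) (hN : 0 < N)
    (θ : Option (Fin (m - 1)) → ℤ)
    (hval : ∀ i, ∀ e ∈ ({a i, b i} : Finset ℕ), ∃ x y, ((N * e : ℕ) : ℤ) = θ x + θ y) :
    ∃ u v : Fin m → ℤ, (u, v) ≠ 0 ∧ ∑ i, (|u i| + |v i|) ≤ ((Nat.log 2 m ^ 2 : ℕ) : ℤ) ∧
      ∑ i, (u i * (a i : ℤ) + v i * (b i : ℤ)) = 0 :=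
  ValuativePeeling.shortRelation_of_edges hm a b hN
    (by rw [Fintype.card_option, Fintype.card_fin]; omega) θ hval

/-- **`stub_integralPeeling` / `stub_polarPeeling`, the valuative (honest) corner** (uniform in
`m ≥ 64`, arbitrary `Γ`, arbitrary Laurent `p`): if every target exponent `N a_i`, `N b_i` is a
sum of two valuations from `{0} ∪ {ord p_j}` — i.e. no target exponent is created by cancellation —
then the exponents satisfy a nonzero integer relation of length `≤ ⌊log₂ m⌋²`.  The map `Γ`, its
degree bound and the identity `Γ(p) = targets` are not used: the content is
`peeling_valuative`. -/
theorem integralPeeling_valuative :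
    ∀ m ≥ 64, ∀ (a b : Fin m → ℕ) (Γ : Fin m → MvPolynomial (Fin (m - 1)) ℂ) (N : ℕ)
      (p : Fin (m - 1) → LaurentSeries ℂ), (∀ i, (Γ i).totalDegree ≤ 2) → 0 < N →
      (∀ i, ∀ e ∈ ({a i, b i} : Finset ℕ), ∃ x y : Option (Fin (m - 1)),
        ((N * e : ℕ) : ℤ) = Option.elim x 0 (fun j => (p j).order) + Option.elim y 0 (fun j => (p j).order)) →
      (∀ i, MvPolynomial.aeval p (Γ i) =
        HahnSeries.single ((N * a i : ℕ) : ℤ) (1 : ℂ) + HahnSeries.single ((N * b i : ℕ) : ℤ) (1 : ℂ)) →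
      ∃ u v : Fin m → ℤ, (u, v) ≠ 0 ∧ ∑ i, (|u i| + |v i|) ≤ ((Nat.log 2 m ^ 2 : ℕ) : ℤ) ∧
        ∑ i, (u i * (a i : ℤ) + v i * (b i : ℤ)) = 0 := by
  intro m hm a b _Γ N p _hΓ hN hval _hp
  exact peeling_valuative hm a b N hN (fun x => Option.elim x 0 fun j => (p j).order) hval

end Summit.ValiantsHypothesis.ValiantsHypothesis.Theorems.BinomialCandidateStubs
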